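import Mathlib
import Summits.RiemannHypothesis.RiemannHypothesis.Theorems.JensenPolynomialsDefs
import Summits.RiemannHypothesis.RiemannHypothesis.Theorems.JensenPolynomialsCumulantDefs
import Summits.RiemannHypothesis.RiemannHypothesis.Theorems.JensenPolynomialsWindowCumulantOfZeroFree

/-!
# Route `JensenPolynomials` — G3-rel: from the zero-free disc in relative form to the tail envelope C1b (real arithmetic)

Support **G3-rel** of the theory seat's β″ split of the ANALYTIC crux `XiGorttwCoeffSmallAnalytic` (THEORY-JENSEN.md
§10.10 (10); route-prep `JensenWindowEGFGlue.lean`: `XiTailOfZeroFreeRel θ η δ₀ N`), PROVED in unfolded form and for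
EVERY real sequence `γ`: if at the shift `M` the window EGF `1 + Σ_{k≤M}(r̃_k/k!)s^k` has no zero on `‖s‖ ≤ θM` with
`log ‖F·e^{−P₃}‖ ≤ η·(8/3)·θ⁴·M³·Δ(M)⁴` there (B1-rel at `M`), `Δ(M)² > 0`, `δ₀ ≤ 2MΔ(M)²` (the `XiDeltaLower` input),
`η ≤ 1` and `16θ²δ₀ ≥ 1`, then the Hermite-frame cumulants obey the C1b cap with the route's `jensenCap`:
`|Ũ_k(M)| ≤ (k·4^{k−3}/3)·(k−1)!·2^{k/2}·M^{−(k−2)/2}` for `4 ≤ k ≤ M` — `hermiteCumulant_abs_le_of_zeroFreeRel`.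
Ingredients: G1 `windowCumulant_abs_le_of_zeroFree` (`JensenPolynomialsWindowCumulantOfZeroFree`) and the arithmetic
`cap_of_windowBound`: `|ũ_k|/Δ^k ≤ (16/3)η·k!·θ^{4−k}M^{3−k}Δ^{4−k}` and the ratio to the cap is
`η⁻¹(4θ√δ)^{k−4} ≥ 1` (`δ = 2MΔ² ≥ δ₀`, `16θ²δ₀ ≥ 1`).  So B1-rel ∧ XiDeltaLower ⟹ C1b is in the kernel modulo
unfolding `windowEGFPoly`/`windowCubic`/`envCapGen jensenCap` (theory ports `JensenWindowEGF`, `JensenCumulantSplitGen`).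
Cell rh-jensen (HUMAN RULING D-0040).  RH-FREE; nothing here is about `ξ` or the zeros of `ζ`.
-/

noncomputable section
-- D-0017: `Summit.RiemannHypothesis.RiemannHypothesis.…` duplicates the namespace BY DESIGN (single-problem summit).
set_option linter.dupNamespace false

open Real
open scoped Nat

namespace Summit.RiemannHypothesis.RiemannHypothesis.Theorems.JensenPolynomials

open Literature.NumberTheory.LFunctions

/-- **The arithmetic of G3-rel.** For `k ≥ 4`, `Δ > 0`, `D = Δ²`, `δ₀ ≤ 2MD`, `16θ²δ₀ ≥ 1`, `η ≤ 1`: a bound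
`|u| ≤ 2·k!·(η(8/3)θ⁴M³D²)/(θM)^k` gives `|u|/Δ^k ≤ (k·4^{k−3}/3)·(k−1)!·2^{k/2}/M^{(k−2)/2}`
(the ratio of the two sides is `η⁻¹(4θ√(2MD))^{k−4} ≥ 1`). -/
theorem cap_of_windowBound (M k : ℕ) (θ η δ₀ D Δ u : ℝ) (hθ : 0 < θ) (hη : η ≤ 1)
    (hside : 1 ≤ 16 * θ ^ 2 * δ₀) (hM : 1 ≤ M) (hk : 4 ≤ k) (hΔ : 0 < Δ) (hD : Δ ^ 2 = D)
    (hδ : δ₀ ≤ 2 * M * D)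
    (hu : |u| ≤ 2 * (k ! : ℝ) * (η * (8 / 3) * θ ^ 4 * (M : ℝ) ^ 3 * D ^ 2) / (θ * M) ^ k) :
    |u| / Δ ^ k ≤ ((k : ℝ) * 4 ^ (k - 3) / 3) * ((k - 1)! : ℝ) * (2 : ℝ) ^ ((k : ℝ) / 2) /
      (M : ℝ) ^ (((k : ℝ) - 2) / 2) := by
  obtain ⟨j, rfl⟩ : ∃ j, k = j + 4 := ⟨k - 4, by omega⟩
  have hMpos : (0 : ℝ) < M := by exact_mod_cast (show 0 < M by omega)
  have hDpos : 0 < D := by rw [← hD]; positivity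
  -- rpow simplifications
  have h2 : (2 : ℝ) ^ ((((j + 4 : ℕ) : ℝ)) / 2) = 4 * Real.sqrt 2 ^ j := by
    rw [show (((j + 4 : ℕ) : ℝ)) / 2 = (1 / 2 : ℝ) * (j : ℝ) + 2 by push_cast; ring,
      Real.rpow_add (by norm_num : (0:ℝ) < 2), Real.rpow_mul (by norm_num : (0:ℝ) ≤ 2),
      Real.rpow_natCast, ← Real.sqrt_eq_rpow, Real.rpow_two]
    ring
  have hMr : (M : ℝ) ^ ((((j + 4 : ℕ) : ℝ) - 2) / 2) = M * Real.sqrt M ^ j := by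
    rw [show ((((j + 4 : ℕ) : ℝ)) - 2) / 2 = (1 / 2 : ℝ) * (j : ℝ) + 1 by push_cast; ring,
      Real.rpow_add hMpos, Real.rpow_mul hMpos.le, Real.rpow_natCast, Real.rpow_one, ← Real.sqrt_eq_rpow]
    ring
  rw [h2, hMr, show j + 4 - 3 = j + 1 by omega, show j + 4 - 1 = j + 3 by omega]
  -- 4 θ √(2 M D) ≥ 1
  have hsq : Real.sqrt 2 * Δ * Real.sqrt M = Real.sqrt (2 * M * D) := by
    rw [← hD, show 2 * (M:ℝ) * Δ ^ 2 = (2 * M) * Δ ^ 2 by ring, Real.sqrt_mul (by positivity),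
      Real.sqrt_sq hΔ.le, Real.sqrt_mul (by norm_num)]
    ring
  have hx1 : 1 ≤ 4 * θ * (Real.sqrt 2 * Δ * Real.sqrt M) := by
    rw [hsq]
    have h16 : 1 ≤ 16 * θ ^ 2 * (2 * M * D) := le_trans hside (by nlinarith [hδ, sq_nonneg θ])
    have hnn : 0 ≤ 4 * θ * Real.sqrt (2 * M * D) := by positivity
    have hsq2 : (4 * θ * Real.sqrt (2 * M * D)) ^ 2 = 16 * θ ^ 2 * (2 * M * D) := by
      rw [mul_pow, mul_pow, Real.sq_sqrt (by positivity)]; ring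
    nlinarith [hsq2]
  have hpowj : 1 ≤ (4 * θ * (Real.sqrt 2 * Δ * Real.sqrt M)) ^ j := one_le_pow₀ hx1
  -- factorial bookkeeping: (j+4)! = (j+4)·(j+3)!
  have hfac : ((((j + 4)! : ℕ)) : ℝ) = (((j + 4 : ℕ) : ℝ)) * ((((j + 3)! : ℕ)) : ℝ) := by
    rw [show (j + 4)! = (j + 3 + 1)! from rfl, Nat.factorial_succ]; push_cast; ring
  have hD2 : D ^ 2 = Δ ^ 4 := by rw [← hD]; ring
  have hΔk : 0 < Δ ^ (j + 4) := pow_pos hΔ _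
  have hθM : 0 < (θ * M) ^ (j + 4) := by positivity
  have hbound : |u| * (θ * M) ^ (j + 4) ≤
      2 * ((((j + 4)! : ℕ)) : ℝ) * (η * (8 / 3) * θ ^ 4 * (M : ℝ) ^ 3 * D ^ 2) := by
    have := hu; rw [le_div_iff₀ hθM] at this; exact_mod_cast this
  rw [div_le_div_iff₀ hΔk (by positivity)]
  -- the key comparison
  have key : 2 * ((((j + 4)! : ℕ)) : ℝ) * (η * (8 / 3) * θ ^ 4 * (M : ℝ) ^ 3 * D ^ 2) * ((M : ℝ) * Real.sqrt M ^ j)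
      ≤ ((((j + 4 : ℕ) : ℝ)) * 4 ^ (j + 1) / 3 * ((((j + 3)! : ℕ)) : ℝ) * (4 * Real.sqrt 2 ^ j)) * Δ ^ (j + 4)
        * (θ * M) ^ (j + 4) := by
    rw [hfac, hD2]
    have e1 : 2 * ((((j + 4 : ℕ) : ℝ)) * ((((j + 3)! : ℕ)) : ℝ)) * (η * (8 / 3) * θ ^ 4 * (M : ℝ) ^ 3 * Δ ^ 4) *
        ((M : ℝ) * Real.sqrt M ^ j)
        = ((16 / 3) * ((((j + 4 : ℕ) : ℝ)) * ((((j + 3)! : ℕ)) : ℝ)) * θ ^ 4 * (M : ℝ) ^ 4 * Δ ^ 4) *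
          (η * Real.sqrt M ^ j) := by ring
    have hsM : Real.sqrt M ^ j * Real.sqrt M ^ j = (M : ℝ) ^ j := by
      rw [← mul_pow, Real.mul_self_sqrt hMpos.le]
    have e2 : ((((j + 4 : ℕ) : ℝ)) * 4 ^ (j + 1) / 3 * ((((j + 3)! : ℕ)) : ℝ) * (4 * Real.sqrt 2 ^ j)) *
        Δ ^ (j + 4) * (θ * M) ^ (j + 4)
        = ((16 / 3) * ((((j + 4 : ℕ) : ℝ)) * ((((j + 3)! : ℕ)) : ℝ)) * θ ^ 4 * (M : ℝ) ^ 4 * Δ ^ 4) *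
          ((4 * θ * (Real.sqrt 2 * Δ * Real.sqrt M)) ^ j * Real.sqrt M ^ j) := by
      rw [show (4 * θ * (Real.sqrt 2 * Δ * Real.sqrt M)) ^ j * Real.sqrt M ^ j =
          4 ^ j * θ ^ j * Real.sqrt 2 ^ j * Δ ^ j * (Real.sqrt M ^ j * Real.sqrt M ^ j) by ring, hsM]
      ring
    rw [e1, e2]
    have hC : 0 ≤ (16 / 3) * ((((j + 4 : ℕ) : ℝ)) * ((((j + 3)! : ℕ)) : ℝ)) * θ ^ 4 * (M : ℝ) ^ 4 * Δ ^ 4 := by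
      positivity
    apply mul_le_mul_of_nonneg_left _ hC
    calc η * Real.sqrt M ^ j ≤ 1 * Real.sqrt M ^ j := by gcongr
      _ ≤ (4 * θ * (Real.sqrt 2 * Δ * Real.sqrt M)) ^ j * Real.sqrt M ^ j := by gcongr
  have h1 : |u| * ((M : ℝ) * Real.sqrt M ^ j) * (θ * M) ^ (j + 4) ≤
      ((((j + 4 : ℕ) : ℝ)) * 4 ^ (j + 1) / 3 * ((((j + 3)! : ℕ)) : ℝ) * (4 * Real.sqrt 2 ^ j)) * Δ ^ (j + 4)
        * (θ * M) ^ (j + 4) := by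
    calc |u| * ((M : ℝ) * Real.sqrt M ^ j) * (θ * M) ^ (j + 4)
        = (|u| * (θ * M) ^ (j + 4)) * ((M : ℝ) * Real.sqrt M ^ j) := by ring
      _ ≤ (2 * ((((j + 4)! : ℕ)) : ℝ) * (η * (8 / 3) * θ ^ 4 * (M : ℝ) ^ 3 * D ^ 2)) *
          ((M : ℝ) * Real.sqrt M ^ j) := by gcongr
      _ ≤ _ := key
  have h2' := le_of_mul_le_mul_right h1 hθM
  push_cast at h2' ⊢
  exact h2'


/-- **G3-rel at one shift, PROVED (ξ-free): B1-rel at `M` ∧ `δ₀ ≤ 2MΔ(M)²` ⟹ the C1b caps at `M` for `4 ≤ k ≤ M`.** -/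
theorem hermiteCumulant_abs_le_of_zeroFreeRel (γ : ℕ → ℝ) (M : ℕ) (θ η δ₀ : ℝ) (hθ : 0 < θ) (hη : η ≤ 1)
    (hside : 1 ≤ 16 * θ ^ 2 * δ₀) (hM : 1 ≤ M) (hΔ : 0 < gorttwDeltaSq γ M)
    (hδ : δ₀ ≤ 2 * M * gorttwDeltaSq γ M)
    (hzf : ∀ s : ℂ, ‖s‖ ≤ θ * M →
      (1 + ∑ k ∈ Finset.Icc 1 M, (((windowSeqDown γ M k / (k ! : ℝ) : ℝ)) : ℂ) * s ^ k) ≠ 0 ∧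
        Real.log ‖(1 + ∑ k ∈ Finset.Icc 1 M, (((windowSeqDown γ M k / (k ! : ℝ) : ℝ)) : ℂ) * s ^ k) *
          Complex.exp (-(s - ((gorttwDeltaSq γ M : ℝ) : ℂ) * s ^ 2 +
            ((gorttwU3 γ M : ℝ) : ℂ) * s ^ 3 / 6))‖ ≤
          η * (8 / 3) * θ ^ 4 * (M : ℝ) ^ 3 * (gorttwDeltaSq γ M) ^ 2) :
    ∀ k : ℕ, 4 ≤ k → k ≤ M →
      |hermiteCumulant γ M k| ≤ ((k : ℝ) * 4 ^ (k - 3) / 3) * ((k - 1)! : ℝ) * (2 : ℝ) ^ ((k : ℝ) / 2) /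
        (M : ℝ) ^ (((k : ℝ) - 2) / 2) := by
  intro k hk hkM
  have hG1 := windowCumulant_abs_le_of_zeroFree γ M θ _ (gorttwDeltaSq γ M) (gorttwU3 γ M) hθ hM hzf k hk hkM
  have hΔpos : 0 < gorttwDelta γ M := Real.sqrt_pos.2 hΔ
  have hD : gorttwDelta γ M ^ 2 = gorttwDeltaSq γ M := Real.sq_sqrt hΔ.le
  unfold hermiteCumulant
  rw [abs_div, abs_of_pos (pow_pos hΔpos k)]
  exact cap_of_windowBound M k θ η δ₀ (gorttwDeltaSq γ M) (gorttwDelta γ M) (windowCumulant γ M k) hθ hη hside hM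
    hk hΔpos hD hδ hG1

end Summit.RiemannHypothesis.RiemannHypothesis.Theorems.JensenPolynomials

end
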